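import Mathlib
import HarnessLib
import Literature.AlgebraicGeometry.Ramification.InertiaNormalSylow
import Literature.AlgebraicGeometry.Resolution.RegularLocalRingsProofs
import Summits.ResolutionOfSingularities.ResolutionOfSingularities.Theorems.WildQuotientsWildQuotientResolutionKSRationalMapDomain

/-!
# Kollár–Szabó going down, (K4)/(K5): the induction on the dimension, from an abstract
# blow-up step (crux `WildQuotients.WildQuotientResolution`, stub `stub_phaseZeroHighDim`)

Crux stmt-ResolutionOfSingularities-15640 (`WildQuotientResolution`), registered stub `stub_phaseZeroHighDim`;
programme: discharge the named fact `Literature.AlgebraicGeometry.GroupActions.KollarSzaboGoingDown`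
(Reichstein–Youssin 2000, App., Prop. A.2) behind hand 6-g4's negative side-lemma ✓p824255 (memo
PHASE0-KS-EIGENLINE.md of hand 8-g0, items (K1)–(K5)).

The printed proof ("by induction on `dim X` … blow up `x` … the exceptional divisor `E ≅ ℙ(T_x X)` carries a
linear action of `H`, which has a fixed point since `H` is abelian … the rational map is defined at the
generic point of `E` since `Y` is proper") is organised here as an induction on `n = dim 𝒪_{X,x}` for the
RATIONAL-MAP form of the statement:

> `P n`: for `X` integral, separated of finite type over an algebraically closed `K`, a finite abelian `H`
> acting on `X` over `K`, a closed point `x` with `𝒪_{X,x}` regular of dimension `≤ n` and `H ≤ I_x`, a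
> proper `Y/K` with an `H`-action, and an `H`-EQUIVARIANT `K`-morphism `φ : W → Y` on an `H`-stable
> non-empty open `W ⊆ X`, the group `H` lies in the inertia group of some point of `Y`.

* `mem_inertiaSubgroup_of_equivariant` — inertia is transported along an equivariant morphism defined
  on a stable open (`I_x ≤ I_{Φ(x)}`).
* `preimage_preimage_eq_of_comm`, `resLE_comp_equivariant` — pulling an equivariant morphism on a
  stable open back along an equivariant morphism gives an equivariant morphism on a stable open.
* `goingDown_zero` — `P 0`: `𝒪_{X,x}` is a field, hence a valuation ring, so `x` lies in the (stable)
  domain of definition of `[φ]` (✓`KSGoingDown.exists_stable_equivariant_extension`) and `Φ(x)` works.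
* `goingDown_succ_of_step` / `goingDown_of_step` — `P n → P (n+1)` and `∀ n, P n` from the ABSTRACT
  BLOW-UP STEP `hstep`: for `dim 𝒪_{X,x} = n + 1` there are an integral `X̃` with an `H`-action and a
  dominant equivariant `b : X̃ → X`, a point `η ∈ X̃` whose local ring is a valuation ring, and an
  integral separated finite-type `E/K` with an `H`-action over `K`, an equivariant `i : E → X̃` over `X`
  hitting `η`, and a closed point `x₁ ∈ E` with `𝒪_{E,x₁}` regular of dimension `n` and `H ≤ I_{x₁}` —
  in print: `X̃ = Bl_x X`, `η` = the generic point of the exceptional divisor `E ≅ ℙ^n_K` (a discrete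
  valuation ring, `X̃` being regular along `E`), `x₁` = an `H`-eigenline in `T_x X` (items (K2)/(K4),
  hand 8 lineage; ✓`AbelianEigenlineStalk` p826946 gives the eigenline). The induction step pulls `φ`
  back to `b⁻¹(W)`, extends it `H`-equivariantly across `η` (✓p827851/p827989), restricts to `E` along
  `i` and applies `P n`.

What remains for `KollarSzaboGoingDown_holds` (census): (K2)/(K4) = `hstep` (the equivariant point
blow-up with its exceptional divisor), and (K5a) the passage from a proper birational equivariant
`π : Y → X` to an equivariant section over an `H`-stable dense open (two sections over the iso locus agree).

[OURS · crux stmt-ResolutionOfSingularities-15640 · helper toward `stub_phaseZeroHighDim` (conditional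
assembly of a named fact's proof; NOT a proof of the stub); counted 0; AI-level work, weaker than expert
review.] [cite: ReichsteinYoussin2000, Appendix (Kollár–Szabó), Prop. A.2 and its proof]
-/

-- single-problem summit: the doubled namespace component `ResolutionOfSingularities` is forced
set_option linter.dupNamespace false

noncomputable section

open CategoryTheory CategoryTheory.Limits AlgebraicGeometry TopologicalSpace IsLocalRing
open Literature.AlgebraicGeometry.Ramification

namespace Summit.ResolutionOfSingularities.ResolutionOfSingularities.Theorems.WildQuotientResolution.KSGoingDown

universe u v

/-! ## Inertia along equivariant morphisms from stable opens -/

section Transport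

variable {X Y : Scheme.{u}} {G : Type v} [Group G] (σ : G →* Aut X) (τ : G →* Aut Y)

/-- **Inertia is transported along an equivariant morphism defined on a stable open**: if
`Φ : D → Y` (`D ⊆ X` a `G`-stable open) satisfies `σ_g|_D ≫ Φ = Φ ≫ τ_g` and `g ∈ I_x` for a point
`x ∈ D`, then `g ∈ I_{Φ(x)}` (AS2011 2.4: `I_y` is the stabiliser of any field-valued point localised
at `y`, ✓`mem_inertiaSubgroup_iff_comp_eq`). [folklore] -/
theorem mem_inertiaSubgroup_of_equivariant {D : X.Opens} (hD : ∀ g, (σ g).hom ⁻¹ᵁ D = D)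
    (Φ : (D : Scheme.{u}) ⟶ Y) (hΦ : ∀ g, (σ g).hom.resLE D D (hD g).ge ≫ Φ = Φ ≫ (τ g).hom)
    {x : X} (hxD : x ∈ D) {g : G} (hg : g ∈ inertiaSubgroup σ x) :
    g ∈ inertiaSubgroup τ (Φ.base ⟨x, hxD⟩) := by
  -- the `κ(x')`-point of `Y` through `Φ`, `x' = x` seen in `D`
  set x' : (D : Scheme.{u}) := ⟨x, hxD⟩ with hx'
  let Kx : CommRingCat.{u} := (D : Scheme.{u}).residueField x'
  let pt : Spec (.of Kx) ⟶ Y := (D : Scheme.{u}).fromSpecResidueField x' ≫ Φ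
  -- `g` fixes the canonical point of `x'` in `D`, because it fixes that of `x` in `X`
  have H1 : (D : Scheme.{u}).fromSpecResidueField x' ≫ D.ι =
      Spec.map (D.ι.residueFieldMap x') ≫ X.fromSpecResidueField (D.ι.base x') :=
    (Scheme.Hom.SpecMap_residueFieldMap_fromSpecResidueField D.ι x').symm
  have hg' : X.fromSpecResidueField (D.ι.base x') ≫ (σ g).hom =
      X.fromSpecResidueField (D.ι.base x') := (mem_inertiaSubgroup_iff σ).mp hg
  have hfix : (D : Scheme.{u}).fromSpecResidueField x' ≫ (σ g).hom.resLE D D (hD g).ge =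
      (D : Scheme.{u}).fromSpecResidueField x' := by
    rw [← cancel_mono D.ι, Category.assoc, Scheme.Hom.resLE_comp_ι, ← Category.assoc, H1,
      Category.assoc, hg']
  have key : g ∈ inertiaSubgroup τ (pt.base (closedPoint Kx)) := by
    refine (mem_inertiaSubgroup_iff_comp_eq τ pt g).mpr ?_
    change ((D : Scheme.{u}).fromSpecResidueField x' ≫ Φ) ≫ (τ g).hom =
      (D : Scheme.{u}).fromSpecResidueField x' ≫ Φ
    rw [Category.assoc, ← hΦ g, ← Category.assoc, hfix]
  have hpt : pt.base (closedPoint Kx) = Φ.base x' := by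
    change (((D : Scheme.{u}).fromSpecResidueField x' ≫ Φ)).base (closedPoint _) = _
    rw [Scheme.Hom.comp_base, TopCat.coe_comp, Function.comp_apply,
      Scheme.fromSpecResidueField_apply]
  rw [hpt] at key
  exact key

variable {X' : Scheme.{u}} (σ' : G →* Aut X') (i : X' ⟶ X)

omit τ in
/-- The preimage of a `G`-stable open under an equivariant morphism is `G`-stable. [folklore] -/
theorem preimage_preimage_eq_of_comm (hi : ∀ g, (σ' g).hom ≫ i = i ≫ (σ g).hom) {D : X.Opens}
    (hD : ∀ g, (σ g).hom ⁻¹ᵁ D = D) (g : G) : (σ' g).hom ⁻¹ᵁ (i ⁻¹ᵁ D) = i ⁻¹ᵁ D := by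
  rw [← Scheme.Hom.comp_preimage, hi, Scheme.Hom.comp_preimage, hD]

/-- **Equivariant pullback**: for an equivariant `i : X' → X` and an equivariant `Φ : D → Y` on a
`G`-stable open `D ⊆ X`, the composite `i⁻¹(D) → D → Y` is equivariant. [folklore] -/
theorem resLE_comp_equivariant (hi : ∀ g, (σ' g).hom ≫ i = i ≫ (σ g).hom) {D : X.Opens}
    (hD : ∀ g, (σ g).hom ⁻¹ᵁ D = D) (Φ : (D : Scheme.{u}) ⟶ Y)
    (hΦ : ∀ g, (σ g).hom.resLE D D (hD g).ge ≫ Φ = Φ ≫ (τ g).hom) (g : G) :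
    (σ' g).hom.resLE (i ⁻¹ᵁ D) (i ⁻¹ᵁ D) (preimage_preimage_eq_of_comm σ σ' i hi hD g).ge ≫
        (i.resLE D (i ⁻¹ᵁ D) le_rfl ≫ Φ) = (i.resLE D (i ⁻¹ᵁ D) le_rfl ≫ Φ) ≫ (τ g).hom := by
  have key : (σ' g).hom.resLE (i ⁻¹ᵁ D) (i ⁻¹ᵁ D) (preimage_preimage_eq_of_comm σ σ' i hi hD g).ge ≫
      i.resLE D (i ⁻¹ᵁ D) le_rfl = i.resLE D (i ⁻¹ᵁ D) le_rfl ≫ (σ g).hom.resLE D D (hD g).ge := by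
    rw [← cancel_mono D.ι]
    simp only [Category.assoc, Scheme.Hom.resLE_comp_ι, Scheme.Hom.resLE_comp_ι_assoc]
    rw [hi]
  rw [← Category.assoc, key, Category.assoc, hΦ g, Category.assoc]

end Transport

/-! ## The induction -/

section Induction

/-- A regular local ring of Krull dimension `≤ 0` is a valuation ring (it is a field). [folklore] -/
theorem valuationRing_of_isRegularLocalRing_of_ringKrullDim_le_zero (R : Type u) [CommRing R]
    [IsRegularLocalRing R] [IsDomain R] (h : ringKrullDim R ≤ 0) : ValuationRing R := by
  obtain ⟨n, hn⟩ := Literature.AlgebraicGeometry.Resolution.ringKrullDim_eq_nat R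
  have hn0 : n = 0 := by
    have : (n : WithBot ℕ∞) ≤ 0 := hn ▸ h
    exact_mod_cast (le_antisymm (by exact_mod_cast this) (Nat.zero_le n))
  subst hn0
  have hF : IsField R := by
    simpa [← (isRegularLocalRing_iff R).mp ‹_›, Submodule.spanFinrank_eq_zero_iff_eq_bot,
      IsNoetherian.noetherian, ← isField_iff_maximalIdeal_eq] using hn
  have hpre : PreValuationRing R := by
    refine ⟨fun a b => ?_⟩
    by_cases ha : a = 0
    · exact ⟨0, Or.inr (by simp [ha])⟩
    · obtain ⟨c, hc⟩ := hF.mul_inv_cancel ha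
      exact ⟨c * b, Or.inl (by rw [← mul_assoc, hc, one_mul])⟩
  exact ⟨⟩

/-- **`P 0`, and more generally the case where `𝒪_{X,x}` is a valuation ring**: then `x` lies in the
`H`-stable domain of definition of the equivariant rational map `[φ]`
(✓`exists_stable_equivariant_extension`), and `H ≤ I_x ≤ I_{Φ(x)}`. [cite: ReichsteinYoussin2000,
Appendix, proof of Prop. A.2] -/
theorem goingDown_of_valuationRing {K : Type u} [Field K] (X : Scheme.{u}) (sX : X ⟶ Spec (.of K))
    [IsIntegral X] {H : Type v} [Group H] (σ : H →* Aut X) (x : X)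
    (hval : ValuationRing (X.presheaf.stalk x)) (hfix : ∀ h, h ∈ inertiaSubgroup σ x)
    (Y : Scheme.{u}) (sY : Y ⟶ Spec (.of K)) [UniversallyClosed sY] [LocallyOfFiniteType sY]
    [Y.IsSeparated] (τ : H →* Aut Y) (W : X.Opens) (hW : (W : Set X).Nonempty)
    (hWst : ∀ h, (σ h).hom ⁻¹ᵁ W = W) (φ : (W : Scheme.{u}) ⟶ Y) (hφ : φ ≫ sY = W.ι ≫ sX)
    (hφeq : ∀ h, (σ h).hom.resLE W W (hWst h).ge ≫ φ = φ ≫ (τ h).hom) :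
    ∃ y : Y, ∀ h, h ∈ inertiaSubgroup τ y := by
  haveI : (Spec (CommRingCat.of K)).IsSeparated := inferInstance
  let ψ : X.PartialMap Y := ⟨W, W.2.dense hW, φ⟩
  obtain ⟨D, hD, -, Φ, hxD, -, -, hΦeq⟩ :=
    exists_stable_equivariant_extension sX sY σ τ ψ hφ hWst hφeq hval
  exact ⟨Φ.base ⟨x, hxD⟩, fun h => mem_inertiaSubgroup_of_equivariant σ τ hD Φ hΦeq hxD (hfix h)⟩


/-- **Kollár–Szabó going down, rational-map form, by induction on `dim 𝒪_{X,x}` from the abstract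
blow-up step.** See the module docstring for the statement `P n` proved for every `n` and for the
hypothesis `hstep` (the equivariant point blow-up with its exceptional divisor, items (K2)/(K4)).
The induction: `P 0` is `goingDown_of_valuationRing` (a regular local ring of dimension `0` is a
field); for `dim 𝒪_{X,x} = n + 1`, pull the equivariant `φ : W → Y` back along the equivariant dominant
`b : X̃ → X`, extend it `H`-equivariantly across the valuation-ring point `η`
(✓`exists_stable_equivariant_extension`) to an `H`-stable open `D ∋ η`, restrict along the equivariant
`i : E → X̃` (whose image meets `D` at `η`) and apply `P n` at the fixed point `x₁ ∈ E`.
[cite: ReichsteinYoussin2000, Appendix (Kollár–Szabó), proof of Prop. A.2] -/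
theorem goingDown_of_step
    (hstep : ∀ (K : Type) [Field K] [IsAlgClosed K] (X : Scheme.{0}) (sX : X ⟶ Spec (.of K))
      [IsIntegral X] [IsSeparated sX] [LocallyOfFiniteType sX] [QuasiCompact sX]
      (H : Type) [CommGroup H] [Finite H] (σ : H →* Aut X), (∀ h, (σ h).hom ≫ sX = sX) →
      ∀ (x : X), IsClosed ({x} : Set X) → IsRegularLocalRing (X.presheaf.stalk x) →
      (∀ h, h ∈ inertiaSubgroup σ x) → ∀ n : ℕ, ringKrullDim (X.presheaf.stalk x) = (n + 1 : ℕ) →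
      ∃ (X' : Scheme.{0}) (_ : IsIntegral X') (σ' : H →* Aut X') (b : X' ⟶ X) (_ : IsDominant b)
        (_ : ∀ h, (σ' h).hom ≫ b = b ≫ (σ h).hom) (η : X') (_ : ValuationRing (X'.presheaf.stalk η))
        (E : Scheme.{0}) (sE : E ⟶ Spec (.of K)) (_ : IsIntegral E) (_ : IsSeparated sE)
        (_ : LocallyOfFiniteType sE) (_ : QuasiCompact sE) (σE : H →* Aut E)
        (_ : ∀ h, (σE h).hom ≫ sE = sE) (i : E ⟶ X') (_ : ∀ h, (σE h).hom ≫ i = i ≫ (σ' h).hom)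
        (_ : i ≫ b ≫ sX = sE) (_ : η ∈ Set.range i.base) (x₁ : E),
        IsClosed ({x₁} : Set E) ∧ IsRegularLocalRing (E.presheaf.stalk x₁) ∧
        (∀ h, h ∈ inertiaSubgroup σE x₁) ∧ ringKrullDim (E.presheaf.stalk x₁) = n) :
    ∀ (n : ℕ) (K : Type) [Field K] [IsAlgClosed K] (X : Scheme.{0}) (sX : X ⟶ Spec (.of K))
      [IsIntegral X] [IsSeparated sX] [LocallyOfFiniteType sX] [QuasiCompact sX]
      (H : Type) [CommGroup H] [Finite H] (σ : H →* Aut X) (_ : ∀ h, (σ h).hom ≫ sX = sX)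
      (x : X) (_ : IsClosed ({x} : Set X)) (_ : IsRegularLocalRing (X.presheaf.stalk x))
      (_ : ∀ h, h ∈ inertiaSubgroup σ x) (_ : ringKrullDim (X.presheaf.stalk x) ≤ n)
      (Y : Scheme.{0}) (sY : Y ⟶ Spec (.of K)) [IsProper sY] (τ : H →* Aut Y)
      (W : X.Opens) (_ : (W : Set X).Nonempty) (hWst : ∀ h, (σ h).hom ⁻¹ᵁ W = W)
      (φ : (W : Scheme.{0}) ⟶ Y) (_ : φ ≫ sY = W.ι ≫ sX)
      (_ : ∀ h, (σ h).hom.resLE W W (hWst h).ge ≫ φ = φ ≫ (τ h).hom),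
      ∃ y : Y, ∀ h, h ∈ inertiaSubgroup τ y := by
  intro n
  induction n with
  | zero =>
    intro K _ _ X sX _ _ _ _ H _ _ σ hσ x hxcl hreg hfix hdim Y sY _ τ W hWne hWst φ hφ hφeq
    haveI := hreg
    haveI : Y.IsSeparated := by
      constructor
      rw [show terminal.from Y = sY ≫ terminal.from _ from terminal.hom_ext _ _]
      infer_instance
    exact goingDown_of_valuationRing X sX σ x
      (valuationRing_of_isRegularLocalRing_of_ringKrullDim_le_zero _ (by exact_mod_cast hdim))
      hfix Y sY τ W hWne hWst φ hφ hφeq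
  | succ n ih =>
    intro K _ _ X sX _ _ _ _ H _ _ σ hσ x hxcl hreg hfix hdim Y sY _ τ W hWne hWst φ hφ hφeq
    haveI := hreg
    -- either `dim 𝒪_{X,x} ≤ n` (induction hypothesis directly) or `= n + 1` (blow-up step)
    obtain ⟨m, hm⟩ := Literature.AlgebraicGeometry.Resolution.ringKrullDim_eq_nat (X.presheaf.stalk x)
    by_cases hmn : m ≤ n
    · exact ih K X sX H σ hσ x hxcl hreg hfix (by rw [hm]; exact_mod_cast hmn) Y sY τ W hWne hWst
        φ hφ hφeq
    have hmeq : m = n + 1 := by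
      have h1 : (m : WithBot ℕ∞) ≤ (n + 1 : ℕ) := by rw [← hm]; exact_mod_cast hdim
      have h2 : m ≤ n + 1 := by exact_mod_cast h1
      omega
    rw [hmeq] at hm
    obtain ⟨X', hX', σ', b, hbdom, hb, η, hη, E, sE, hE, hsE₁, hsE₂, hsE₃, σE, hσE, i, hi, hib,
      ⟨e₀, he₀⟩, x₁, hx₁cl, hx₁reg, hx₁fix, hx₁dim⟩ :=
      hstep K X sX H σ hσ x hxcl hreg hfix n hm
    haveI : Y.IsSeparated := by
      constructor
      rw [show terminal.from Y = sY ≫ terminal.from _ from terminal.hom_ext _ _]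
      infer_instance
    -- pull `φ` back along `b`
    let W' : X'.Opens := b ⁻¹ᵁ W
    have hW'ne : (W' : Set X').Nonempty := by
      obtain ⟨w, hw⟩ := hWne
      obtain ⟨z, hz⟩ := hbdom.denseRange.mem_nhds (W.2.mem_nhds hw)
      exact ⟨z, hz⟩
    have hW'st : ∀ h, (σ' h).hom ⁻¹ᵁ W' = W' := preimage_preimage_eq_of_comm σ σ' b hb hWst
    let φ' : (W' : Scheme.{0}) ⟶ Y := b.resLE W W' le_rfl ≫ φ
    have hφ' : φ' ≫ sY = W'.ι ≫ (b ≫ sX) := by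
      change (b.resLE W W' le_rfl ≫ φ) ≫ sY = _
      rw [Category.assoc, hφ, Scheme.Hom.resLE_comp_ι_assoc]
    have hφ'eq : ∀ h, (σ' h).hom.resLE W' W' (hW'st h).ge ≫ φ' = φ' ≫ (τ h).hom :=
      resLE_comp_equivariant σ τ σ' b hb hWst φ hφeq
    let ψ' : X'.PartialMap Y := ⟨W', W'.2.dense hW'ne, φ'⟩
    -- extend equivariantly across the valuation-ring point `η`
    obtain ⟨D, hD, -, Φ, hηD, hΦK, -, hΦeq⟩ :=
      exists_stable_equivariant_extension (b ≫ sX) sY σ' τ ψ' hφ' hW'st hφ'eq hη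
    -- restrict to `E` along `i`
    let WE : E.Opens := i ⁻¹ᵁ D
    have hWEne : (WE : Set E).Nonempty := ⟨e₀, show i.base e₀ ∈ D by rw [he₀]; exact hηD⟩
    have hWEst : ∀ h, (σE h).hom ⁻¹ᵁ WE = WE := preimage_preimage_eq_of_comm σ' σE i hi hD
    let φE : (WE : Scheme.{0}) ⟶ Y := i.resLE D WE le_rfl ≫ Φ
    have hφE : φE ≫ sY = WE.ι ≫ sE := by
      change (i.resLE D WE le_rfl ≫ Φ) ≫ sY = _
      rw [Category.assoc, hΦK, Scheme.Hom.resLE_comp_ι_assoc, ← hib]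
    have hφEeq : ∀ h, (σE h).hom.resLE WE WE (hWEst h).ge ≫ φE = φE ≫ (τ h).hom :=
      resLE_comp_equivariant σ' τ σE i hi hD Φ hΦeq
    haveI := hE; haveI := hsE₁; haveI := hsE₂; haveI := hsE₃
    exact ih K E sE H σE hσE x₁ hx₁cl hx₁reg hx₁fix hx₁dim.le Y sY τ WE hWEne hWEst φE hφE hφEeq

end Induction

end Summit.ResolutionOfSingularities.ResolutionOfSingularities.Theorems.WildQuotientResolution.KSGoingDown

end
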